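import Summits.ValiantsHypothesis.ValiantsHypothesis.Theorems.LacunarySymmetroidMatrixDescartesPivotStaircaseAllK
import Summits.ValiantsHypothesis.ValiantsHypothesis.Theorems.LacunarySymmetroidMatrixDescartesPivotTwoDirections

/-!
# `MatrixDescartes` (stmt-ValiantsHypothesis-18050) — the BARE pole-weaving pencil (no slack at either corner):
# a LONE NULL LETTER against `K − 1` parallel null letters has EXACTLY `2K − 2` positive roots, every `K` — the RANK LADDER of
# the lone-letter sub-rows of `(2, K)₁`: `2K − 2` (lone null) < `2K − 1` (lone full rank) < `2K ≤` (general row)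

HONEST FRAMING.  Cell `pub-symmetroid`, seat `val-sym-mdr-p2` (gen 25); helper file `--supports` the crux
`Theses.LacunarySymmetroid.MatrixDescartes` (OPEN), NO closure claim.  Currency: conjb-1's pivot column (`…CensusPivotDefs`: `pivotPosRoots`).
The slack-free closed form `g(t) = (1 − t)·Σᵢ 8nᵢt^{nᵢ} − t²` of `…PivotStaircaseAllKCalculus` (val-sym-mdr-p2 g24; `g_alternates` on the
`2c + 1` interior weaving points `1 − ω_j`) IS the determinant of the BARE pencil `t·[[−1,1],[1,0]] + diag(1,0) + Σᵢ t^{nᵢ}·diag(0, 8nᵢ)`: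
ONE null letter `e₁e₁ᵀ` (below the pivot) against `c = K − 1` null letters parallel to `e₂e₂ᵀ` (above it) — the family of the tree's
ONE-AGAINST-PARALLEL law (`TwoDirections.pivotPosRoots_le_of_one_against_parallel`, val-sym-mdr-p1 g12: `Z₊ ≤ 2(K − 1)`, all `K`, weak hard
cell; sharpness in the tree only at `K = 3`, `…TwoDirectionsSharp`).  THIS FILE: `det_eq_bare`, **`le_pivotPosRoots_bare`: `Z₊ ≥ 2c`**,
**`pivotPosRoots_bare_eq`: EXACTLY `2c = 2K − 2`**, `exists_loneNull_eq` (every `K ≥ 1`, index one, diagonal null letters).  With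
`…PivotStaircaseNoSlack` (lone FULL-RANK letter: exactly `2K − 1`) and `…PivotStaircaseAllK` (both corners slack: `≥ 2K`, row `[2K, 2K+2]`)
this is the RANK LADDER of the family: each unit of rank added at a corner of the bare pencil buys exactly one positive root.
Nothing here bears on the `(2,K)` row itself, `MatrixDescartes` in its window, the upper pivot rungs, `DoorA26`/`DoorA34`, the registers,
`VP ≠ VNP`.

[folklore] Intermediate value theorem via the tree's certificate kit (`Pivot.le_pivotPosRoots_of_certificate`), g24's calculus
(`g_alternates`, `ω_succ_lt`, `ω_lt_one`) and the one-against-parallel law.  No definitions (local notation only), no named facts.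
-/

set_option linter.dupNamespace false

namespace Summit.ValiantsHypothesis.ValiantsHypothesis.Theorems.LacunarySymmetroidMatrixDescartes.Pivot.PoleWeave

open scoped BigOperators Matrix
open Finset

/-! ### Notation (verbatim from `…PivotStaircaseAllKCalculus`; local, no definitions) -/

/-- The scale `S = 2^{c+7}`. -/
local notation3 (prettyPrint := false) "S⟦" c "⟧" => (2 ^ (c + 7))

/-- The exponents `nᵢ = (S²)^{i+1}`. -/
local notation3 (prettyPrint := false) "n⟦" c ", " i "⟧" => ((S⟦c⟧ * S⟦c⟧) ^ (i + 1))

/-- The slack-free closed form `g(t) = (1 − t)·Σᵢ 8nᵢ t^{nᵢ} − t²`. -/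
local notation3 (prettyPrint := false) "g⟦" c "⟧(" t ")" =>
  ((1 - t) * (∑ i : Fin c, (8 * (n⟦c, (i : ℕ)⟧ : ℝ)) * t ^ (n⟦c, (i : ℕ)⟧)) - t ^ 2)

/-- The gaps `ω_j` of the interior weaving points (`ω₀ = 1/2`, `ω_{2i+1} = 1/(2nᵢ)`, `ω_{2i+2} = 1/(S nᵢ)`). -/
local notation3 (prettyPrint := false) "ω⟦" c ", " j "⟧" =>
  (if j = 0 then ((1 : ℝ) / 2)
    else if j % 2 = 1 then (1 : ℝ) / (2 * (n⟦c, j / 2⟧ : ℝ))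
    else (1 : ℝ) / ((S⟦c⟧ * n⟦c, j / 2 - 1⟧ : ℕ) : ℝ))

/-- The pivot letter `J = [[−1, 1], [1, 0]]`. -/
local notation3 (prettyPrint := false) "Jw" => (!![-1, 1; 1, 0] : Matrix (Fin 2) (Fin 2) ℝ)

/-- The BARE letters: the null `diag(1, 0)` at exponent `0`, then the null `diag(0, 8nᵢ)` at `nᵢ`. -/
local notation3 (prettyPrint := false) "Pb⟦" c "⟧" =>
  (Fin.cons (Matrix.diagonal ![(1 : ℝ), 0])
    (fun i : Fin c => Matrix.diagonal ![(0 : ℝ), 8 * (n⟦c, (i : ℕ)⟧ : ℝ)]) :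
      Fin (c + 1) → Matrix (Fin 2) (Fin 2) ℝ)

/-- The exponents `(0, n₀, …, n_{c−1})`. -/
local notation3 (prettyPrint := false) "dw⟦" c "⟧" =>
  (Fin.cons 0 (fun i : Fin c => n⟦c, (i : ℕ)⟧) : Fin (c + 1) → ℕ)

/-- The index-one witness `w = (2, −1/2)ᵀ`. -/
local notation3 (prettyPrint := false) "Ww" =>
  (Matrix.of fun (i : Fin 2) (_ : Fin 1) => (![(2 : ℝ), -1 / 2] : Fin 2 → ℝ) i)

/-- The two directions `e₁` (`false`) and `e₂` (`true`) as a `Bool`-indexed frame (local notation). -/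
local notation3 (prettyPrint := false) "wB" => (fun b : Bool => cond b ![(0 : ℝ), 1] ![(1 : ℝ), 0])

/-! ### 1. The bare pencil and its determinant -/

/-- **Closed form**: `det (t • J + diag(1, 0) + Σᵢ t^{nᵢ} diag(0, 8nᵢ)) = g(t)`. [folklore] -/
theorem det_eq_bare (c : ℕ) (t : ℝ) : (t ^ 1 • Jw + ∑ k, t ^ (dw⟦c⟧ k) • Pb⟦c⟧ k).det = g⟦c⟧(t) := by
  rw [Fin.sum_univ_succ]
  simp only [Fin.cons_zero, Fin.cons_succ, pow_zero, one_smul, pow_one]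
  rw [Matrix.det_fin_two]
  have h11 : (∑ i : Fin c, t ^ (n⟦c, (i : ℕ)⟧) • Matrix.diagonal ![(0 : ℝ), 8 * (n⟦c, (i : ℕ)⟧ : ℝ)]) 1 1
      = ∑ i : Fin c, (8 * (n⟦c, (i : ℕ)⟧ : ℝ)) * t ^ (n⟦c, (i : ℕ)⟧) := by
    rw [Matrix.sum_apply]
    refine Finset.sum_congr rfl fun i _ => ?_
    simp [Matrix.smul_apply, mul_comm]
  have h00 : (∑ i : Fin c, t ^ (n⟦c, (i : ℕ)⟧) • Matrix.diagonal ![(0 : ℝ), 8 * (n⟦c, (i : ℕ)⟧ : ℝ)]) 0 0 = 0 := by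
    rw [Matrix.sum_apply]; simp [Matrix.smul_apply]
  have h01 : (∑ i : Fin c, t ^ (n⟦c, (i : ℕ)⟧) • Matrix.diagonal ![(0 : ℝ), 8 * (n⟦c, (i : ℕ)⟧ : ℝ)]) 0 1 = 0 := by
    rw [Matrix.sum_apply]; simp [Matrix.smul_apply]
  have h10 : (∑ i : Fin c, t ^ (n⟦c, (i : ℕ)⟧) • Matrix.diagonal ![(0 : ℝ), 8 * (n⟦c, (i : ℕ)⟧ : ℝ)]) 1 0 = 0 := by
    rw [Matrix.sum_apply]; simp [Matrix.smul_apply]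
  simp only [Matrix.add_apply, Matrix.smul_apply]
  rw [h00, h01, h10, h11]
  simp
  ring

/-- The bare letters are `cₖ · w wᵀ` with `w ∈ {e₁, e₂}`: letter `0` is `1·e₁e₁ᵀ`, the letters `≥ 1` are `8nᵢ·e₂e₂ᵀ`. -/
theorem Pb_eq (c : ℕ) (k : Fin (c + 1)) :
    Pb⟦c⟧ k = (Fin.cons (1 : ℝ) (fun i : Fin c => 8 * (n⟦c, (i : ℕ)⟧ : ℝ)) : Fin (c + 1) → ℝ) k
      • Matrix.vecMulVec (wB ((Fin.cons false (fun _ : Fin c => true) : Fin (c + 1) → Bool) k))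
          (wB ((Fin.cons false (fun _ : Fin c => true) : Fin (c + 1) → Bool) k)) := by
  refine Fin.cases ?_ (fun i => ?_) k
  · simp only [Fin.cons_zero]
    ext a b; fin_cases a <;> fin_cases b <;> simp
  · simp only [Fin.cons_succ]
    ext a b; fin_cases a <;> fin_cases b <;> simp

/-! ### 2. The count: exactly `2c` -/

/-- **`Z₊ ≥ 2c`** for the bare pencil: `g` alternates along the `2c + 1` points `1 − ω₀ < ⋯ < 1 − ω_{2c}` (`g_alternates`). -/
theorem le_pivotPosRoots_bare (c : ℕ) : 2 * c ≤ pivotPosRoots 1 (dw⟦c⟧) Jw (Pb⟦c⟧) := by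
  refine le_pivotPosRoots_of_certificate (det_eq_bare c) (fun j : Fin (2 * c + 1) => 1 - ω⟦c, (j : ℕ)⟧)
    (Fin.strictMono_iff_lt_succ.2 fun j => ?_) (fun j => ?_) (fun j => ?_)
  · simp only [Fin.val_castSucc, Fin.val_succ]
    have := ω_succ_lt c j (by omega)
    linarith
  · have := ω_lt_one c j
    linarith
  · simp only [Fin.val_castSucc, Fin.val_succ]
    exact g_alternates c j j.isLt

/-- **`Z₊ ≤ 2c`** for the bare pencil: one null letter (`e₁e₁ᵀ`) against `c` parallel null letters (`e₂e₂ᵀ`), `det J = −1`,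
`m(J,e₁) = 0`, `m(J,e₂) = −1`: the tree's one-against-parallel law. -/
theorem pivotPosRoots_bare_le (c : ℕ) : pivotPosRoots 1 (dw⟦c⟧) Jw (Pb⟦c⟧) ≤ 2 * c := by
  classical
  have hone : (univ.filter (fun k : Fin (c + 1) => (Fin.cons false (fun _ : Fin c => true) : Fin (c + 1) → Bool) k = false)).card
      = 1 := by
    rw [Finset.card_eq_one]
    refine ⟨0, ?_⟩
    ext k
    simp only [Finset.mem_filter, Finset.mem_univ, true_and, Finset.mem_singleton]
    refine Fin.cases ?_ (fun i => ?_) k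
    · simp
    · simp only [Fin.cons_succ]
      exact ⟨fun h => absurd h (by decide), fun h => absurd h (Fin.succ_ne_zero i)⟩
  have h := TwoDirections.pivotPosRoots_le_of_one_against_parallel 1 (dw⟦c⟧) Jw
    wB (Fin.cons false (fun _ : Fin c => true))
    (Fin.cons (1 : ℝ) (fun i : Fin c => 8 * (n⟦c, (i : ℕ)⟧ : ℝ))) (fun k => ?_) (Pb⟦c⟧) (Pb_eq c)
    (by simp [Matrix.det_fin_two]) (by simp) (by simp) hone
  · simpa using h
  · refine Fin.cases ?_ (fun i => ?_) k
    · simp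
    · simp only [Fin.cons_succ]; positivity

/-- **EXACTLY `2c = 2K − 2`** for the bare pencil (`K = c + 1` letters). -/
theorem pivotPosRoots_bare_eq (c : ℕ) : pivotPosRoots 1 (dw⟦c⟧) Jw (Pb⟦c⟧) = 2 * c :=
  le_antisymm (pivotPosRoots_bare_le c) (le_pivotPosRoots_bare c)

/-- **THE LONE-NULL SUB-ROW IS ATTAINED FOR EVERY `K ≥ 1`**: at format `(2, K)`, pivot exponent `1`, index one, a pencil whose letters
are non-negative multiples of `e₁e₁ᵀ` (exactly one of them, at an exponent `≠ 1`) and of `e₂e₂ᵀ` (the others) has EXACTLY `2K − 2`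
distinct positive determinant roots — the one-against-parallel bound `2(K − 1)` (`TwoDirections.pivotPosRoots_le_of_one_against_parallel`)
is sharp for every `K` (the tree had `K = 3`). -/
theorem exists_loneNull_eq (K : ℕ) (hK : 1 ≤ K) :
    ∃ (d : Fin K → ℕ) (J : Matrix (Fin 2) (Fin 2) ℝ) (P : Fin K → Matrix (Fin 2) (Fin 2) ℝ) (γ : Fin K → ℝ) (side : Fin K → Bool),
      J.IsSymm ∧ (∃ W : Matrix (Fin 2) (Fin 1) ℝ, (J + W * Wᵀ).PosSemidef) ∧ (∀ k, 0 ≤ γ k) ∧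
      (univ.filter (fun k => side k = false)).card = 1 ∧
      (∀ k, P k = γ k • Matrix.vecMulVec (wB (side k)) (wB (side k))) ∧
      pivotPosRoots 1 d J P = 2 * K - 2 := by
  classical
  obtain ⟨c, rfl⟩ : ∃ c, K = c + 1 := ⟨K - 1, by omega⟩
  refine ⟨dw⟦c⟧, Jw, Pb⟦c⟧, Fin.cons (1 : ℝ) (fun i : Fin c => 8 * (n⟦c, (i : ℕ)⟧ : ℝ)), Fin.cons false (fun _ : Fin c => true),
    isSymm_J, ⟨Ww, indexOne_J⟩, fun k => ?_, ?_, Pb_eq c, ?_⟩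
  · refine Fin.cases ?_ (fun i => ?_) k
    · simp
    · simp only [Fin.cons_succ]; positivity
  · rw [Finset.card_eq_one]
    refine ⟨0, ?_⟩
    ext k
    simp only [Finset.mem_filter, Finset.mem_univ, true_and, Finset.mem_singleton]
    refine Fin.cases ?_ (fun i => ?_) k
    · simp
    · simp only [Fin.cons_succ]
      exact ⟨fun h => absurd h (by decide), fun h => absurd h (Fin.succ_ne_zero i)⟩
  · rw [pivotPosRoots_bare_eq]; omega

end Summit.ValiantsHypothesis.ValiantsHypothesis.Theorems.LacunarySymmetroidMatrixDescartes.Pivot.PoleWeave
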